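import Literature.AnabelianGeometry.SemiGraphs.OverStarSectionRigidity
import Literature.AnabelianGeometry.SemiGraphs.VertexAlignedStabilizers
import Literature.AnabelianGeometry.SemiGraphs.CoveringBranchFrames
import Literature.AnabelianGeometry.Anabelioids.ExactFunctorProofs
import HarnessLib

/-!
# The branch functor of a finite étale covering is base change along its SECTION MAP; branch
# alignment (i) makes the section map a monomorphism ([SemiAnbd] Def. 2.2 (i) p. 23, Rem. 2.4.2)

Mochizuki, *Semi-graphs of anabelioids*, Publ. RIMS **42** (2006) 221–322, §2: Def. 2.2 (i) p. 23
(the covering `ℋ → 𝒦` attached to `A ∈ B(𝒦)`: "`ℋ_w` is the anabelioid `(𝒦_u)_P`", the branch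
functors of `ℋ` are print's gluing `X ↦ b₀^* X ×_{b₀^* P} Q`), Rem. 2.4.2 p. 26 (the 2-cells `ψ_b`)
[cite: MochizukiSemiAnbd2006, Def. 2.2(i) p.23].

Two small DEFINITIONS + proofs (abc-iut cell, layer L3; FACT-LIST rows F-1478/F-1487, residual
«abstract-covering rigidity (J1)», brick «BRANCH-SECTION»; seat abc-iut-f-160).  This is
abc-iut-w5-d041's `FiniteEtaleCoveringLocalGlobalSection` ONE LEVEL DOWN — no `B(−)` at all: for
`ψ : ℋ → 𝒦`, a branch `b₁` of `ℋ` at `w` over `b₀` at `u`, and LOCAL witnesses `(α_w, e_w)` at `w`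
(`ψ_w^* ≅ (P × −) ⋙ α_w`) and `(α_f, e_f)` at the edge `f` of `b₁` (`ψ_f^* ≅ (Q × −) ⋙ α_f`):

* `Hom.branchLocalFunctor` — `L_b := α_w ⋙ b₁^* ⋙ α_f⁻¹ : (𝒦_u)_{/P} ⥤ (𝒦_e)_{/Q}`, the branch
  functor of `ℋ` read through the local equivalences, and `Hom.branchLocalIso` —
  `(P × −) ⋙ L_b ≅ b₀^* ⋙ (Q × −)` (from `e_w⁻¹`, the 2-cell `ψ_{b₁}`, `e_f`, the unit of `α_f`);
* `Hom.branchSection` — its SECTION MAP `σ_b : Q ⟶ b₀^* P` (`OverStar.sectionMap`);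
* `Hom.exists_iso_branchLocal_pullback` — **the branch functor is objectwise base change along
  `σ_b`**: `α_f⁻¹(b₁^*(α_w Y)) ≅ Q ×_{σ_b} b₀^* Y` (abc-iut-w5-d041's `OverStar` rigidity; print's
  gluing functor is the case `σ_b =` the inclusion `Q ↪ b₀^* P`);
* `Hom.mono_branchSection` — **if `ψ` is BRANCH-ALIGNED (`Hom.IsBranchAligned`, clause (i)) and `Q`
  is a connected sub-object of `b₀^* P`, then `σ_b` is a monomorphism**: clause (i) in abc-iut-L3-t1's
  equality form `ι_w(Π_{b₁}) = ι_w(Π_w) ∩ Π_{b₀}^{al}` (`map_branchSubgroup_eq_range_inf_aligned`) is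
  VERBATIM the shape of `Hom.IsVertexAligned` (a) with `(ρ_u, ρ′_w, ψ^*)` replaced by
  `(b₀^*, b₁^*, ψ_w^*)` and the definitional square replaced by the 2-cell `ψ_{b₁}`; so
  abc-iut-w4-d079's group half (`comap_range_eq_range_of_aligned`, `mono_of_stabilizer_le`) applies,
  with the two base points `q₁ ∈ F(Q)` (local, stabiliser `Π_f`) and `x₀ ∈ F(b₀^* P)` (from `α_w`,
  stabiliser `ι_w(Π_w)` read along `b₀`), and `F(σ_b)(q₁) = x₀` (`Hom.map_branchSection_basePoint`).

Use: the factorisation `σ_f = σ_b ≫ b₀^*(σ_w) ≫ ψ_{b₀}^A` of the EDGE section, and the functor-level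
content of the `β`-field of abc-iut-L3-t1's `Hom.AlignedLocalData` («the labelling makes `σ_b` the
inclusion»).  No instance, no notation, no `Prop` fact; nothing here takes a side on [IUTchIII]
Cor. 3.12; typed ≠ proved for F-1478/F-1487.
-/

namespace Literature.AnabelianGeometry.SemiGraphs

namespace SemiGraphOfAnabelioids

open CategoryTheory CategoryTheory.Limits CategoryTheory.PreGaloisCategory
open Literature.AnabelianGeometry.Anabelioids

universe v₁ u₁ u

variable {ℋ 𝒦 : SemiGraphOfAnabelioids.{v₁, u₁, u}} (ψ : Hom ℋ 𝒦) (b₁ : ℋ.graph.Branch)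
  (w : ℋ.graph.Vertex) (h₁ : ℋ.graph.abuts b₁ = some w)
  (P : 𝒦.V (ψ.base.vertexMap w)) (αw : Over P ⥤ ℋ.V w) [αw.IsEquivalence]
  (Q : 𝒦.E (𝒦.graph.edgeOf (ψ.base.branchMap b₁)))
  (αf : Over Q ⥤ ℋ.E (ℋ.graph.edgeOf b₁)) [αf.IsEquivalence]

/-! ### The branch functor read through the local equivalences -/

/-- The branch functor `b₁^*` of `ℋ` read through the local equivalences at `w` and at the edge of
`b₁`: `L_b := α_w ⋙ b₁^* ⋙ α_f⁻¹ : (𝒦_u)_{/P} ⥤ (𝒦_e)_{/Q}`. [cite: MochizukiSemiAnbd2006, Def. 2.2(i) p.23] -/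
noncomputable def Hom.branchLocalFunctor : Over P ⥤ Over Q :=
  αw ⋙ (ℋ.pull b₁ w h₁).pullback ⋙ αf.inv

/-- `L_b` preserves equalizers (equivalences do; `b₁^*` is exact). [cite: MochizukiSemiAnbd2006, Def. 2.2(i) p.23] -/
theorem Hom.branchLocalFunctor_preservesLimitsOfShape_walkingParallelPair :
    PreservesLimitsOfShape WalkingParallelPair (Hom.branchLocalFunctor ψ b₁ w h₁ P αw Q αf) := by
  haveI : PreservesFiniteLimits (ℋ.pull b₁ w h₁).pullback := (ℋ.pull b₁ w h₁).property.1
  dsimp only [Hom.branchLocalFunctor]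
  infer_instance

/-- `L_b(𝟙_P)` is terminal. [cite: MochizukiSemiAnbd2006, Def. 2.2(i) p.23] -/
noncomputable def Hom.branchLocalFunctor_isTerminal :
    IsTerminal ((Hom.branchLocalFunctor ψ b₁ w h₁ P αw Q αf).obj (Over.mk (𝟙 P))) := by
  haveI : PreservesFiniteLimits (ℋ.pull b₁ w h₁).pullback := (ℋ.pull b₁ w h₁).property.1
  haveI : PreservesLimitsOfShape (Discrete PEmpty.{1})
      (Hom.branchLocalFunctor ψ b₁ w h₁ P αw Q αf) := by
    dsimp only [Hom.branchLocalFunctor]; infer_instance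
  exact Over.mkIdTerminal.isTerminalObj (Hom.branchLocalFunctor ψ b₁ w h₁ P αw Q αf) (Over.mk (𝟙 P))

variable (ew : (ψ.φV w).pullback ≅ Over.star P ⋙ αw)
  (ef : (ψ.φE (ℋ.graph.edgeOf b₁) (𝒦.graph.edgeOf (ψ.base.branchMap b₁))
      (ψ.base.edgeOf_branchMap b₁).symm).pullback ≅ Over.star Q ⋙ αf)

/-- `(P × −) ⋙ L_b ≅ b₀^* ⋙ (Q × −)`: the local compatibility at `w` (`e_w⁻¹`), the 2-cell `ψ_{b₁}`
(`Hom.φB`), the local compatibility at the edge (`e_f`) and `α_f ⋙ α_f⁻¹ ≅ 𝟭`.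
[cite: MochizukiSemiAnbd2006, Rem. 2.4.2 p.26] -/
noncomputable def Hom.branchLocalIso :
    Over.star P ⋙ Hom.branchLocalFunctor ψ b₁ w h₁ P αw Q αf ≅
      (𝒦.pull (ψ.base.branchMap b₁) (ψ.base.vertexMap w) (ψ.base.abuts_branchMap b₁ w h₁)).pullback ⋙
        Over.star Q :=
  Functor.isoWhiskerRight ew.symm ((ℋ.pull b₁ w h₁).pullback ⋙ αf.inv) ≪≫
    (Functor.isoWhiskerRight (ψ.φB b₁ w h₁) αf.inv :
      ((ψ.φV w).pullback ⋙ (ℋ.pull b₁ w h₁).pullback) ⋙ αf.inv ≅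
        ((𝒦.pull (ψ.base.branchMap b₁) (ψ.base.vertexMap w)
            (ψ.base.abuts_branchMap b₁ w h₁)).pullback ⋙
          (ψ.φE (ℋ.graph.edgeOf b₁) (𝒦.graph.edgeOf (ψ.base.branchMap b₁))
            (ψ.base.edgeOf_branchMap b₁).symm).pullback) ⋙ αf.inv) ≪≫
    Functor.isoWhiskerLeft
      (𝒦.pull (ψ.base.branchMap b₁) (ψ.base.vertexMap w) (ψ.base.abuts_branchMap b₁ w h₁)).pullback
      (Functor.isoWhiskerRight ef αf.inv) ≪≫
    Functor.isoWhiskerLeft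
      ((𝒦.pull (ψ.base.branchMap b₁) (ψ.base.vertexMap w) (ψ.base.abuts_branchMap b₁ w h₁)).pullback ⋙
        Over.star Q) αf.asEquivalence.unitIso.symm

/-- The SECTION MAP `σ_b : Q ⟶ b₀^* P` of the branch functor ("where `b₁^*` places the edge
constituent inside `b₀^* P`"; for print's constructed covering, the inclusion of the component `Q`).
[cite: MochizukiSemiAnbd2006, Def. 2.2(i) p.23] -/
noncomputable def Hom.branchSection :
    Q ⟶ (𝒦.pull (ψ.base.branchMap b₁) (ψ.base.vertexMap w)
      (ψ.base.abuts_branchMap b₁ w h₁)).pullback.obj P :=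
  OverStar.sectionMap (Over.forgetAdjStar P) (Over.forgetAdjStar Q)
    (Hom.branchLocalFunctor ψ b₁ w h₁ P αw Q αf)
    (𝒦.pull (ψ.base.branchMap b₁) (ψ.base.vertexMap w) (ψ.base.abuts_branchMap b₁ w h₁)).pullback
    (Hom.branchLocalIso ψ b₁ w h₁ P αw Q αf ew ef) (Hom.branchLocalFunctor_isTerminal ψ b₁ w h₁ P αw Q αf)

/-- **The branch functor is base change along its section map**: for every `Y ∈ (𝒦_u)_{/P}`,
`α_f⁻¹(b₁^*(α_w Y)) ≅ Q ×_{σ_b} b₀^*(Y)` over `Q`, compatibly with the structure maps.  Print's covering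
attached to `A` is the case where `σ_b` is the inclusion of the component `Q ⊆ b₀^* P`.
[cite: MochizukiSemiAnbd2006, Def. 2.2(i) p.23] -/
theorem Hom.exists_iso_branchLocal_pullback (Y : Over P) :
    ∃ e : (Hom.branchLocalFunctor ψ b₁ w h₁ P αw Q αf).obj Y ≅
        OverStar.pullbackObj (Hom.branchSection ψ b₁ w h₁ P αw Q αf ew ef)
          ((𝒦.pull (ψ.base.branchMap b₁) (ψ.base.vertexMap w)
            (ψ.base.abuts_branchMap b₁ w h₁)).pullback.map Y.hom),
      e.hom ≫ OverStar.pullbackι (Over.forgetAdjStar Q) (Hom.branchSection ψ b₁ w h₁ P αw Q αf ew ef)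
          ((𝒦.pull (ψ.base.branchMap b₁) (ψ.base.vertexMap w)
            (ψ.base.abuts_branchMap b₁ w h₁)).pullback.map Y.hom) =
        (Hom.branchLocalFunctor ψ b₁ w h₁ P αw Q αf).map (OverStar.unit' (Over.forgetAdjStar P) Y) ≫
          OverStar.ιHom (Hom.branchLocalFunctor ψ b₁ w h₁ P αw Q αf) _
            (Hom.branchLocalIso ψ b₁ w h₁ P αw Q αf ew ef) Y.left := by
  haveI := Hom.branchLocalFunctor_preservesLimitsOfShape_walkingParallelPair ψ b₁ w h₁ P αw Q αf
  exact OverStar.exists_iso_pullback (Over.forgetAdjStar P) (Over.forgetAdjStar Q) _ _ _ _ Y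

/-! ### Branch alignment (i) ⟹ `σ_b` is a monomorphism -/

section Mono

variable (Ff : ℋ.E (ℋ.graph.edgeOf b₁) ⥤ FintypeCat.{v₁}) [FiberFunctor Ff]

omit [FiberFunctor Ff] in
/-- The square of the 2-cell `ψ_{b₁}` on automorphism groups of basepoints: `ι_w` (read along `b₀`
through the aligned frame) after `Π_f → Π_w` equals `Π_e → Π_u` (along `b₀`) after `Π_f → Π_e`
(`autMulEquivOfIso_alignIso_pi1Map`). [cite: MochizukiSemiAnbd2006, Rem. 2.4.2 p.26] -/
private theorem Hom.isBranchAligned_square (σ : Aut Ff) :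
    (Aut.autMulEquivOfIso (ψ.alignIso b₁ w h₁ (ψ.base.branchMap b₁) rfl
        ((ℋ.pull b₁ w h₁).pullback ⋙ Ff) Ff (Iso.refl _)).symm)
      (pi1Map (ψ.φV w).pullback ((ℋ.pull b₁ w h₁).pullback ⋙ Ff)
        (Aut.autMulEquivOfIso (Iso.refl ((ℋ.pull b₁ w h₁).pullback ⋙ Ff))
          (pi1Map (ℋ.pull b₁ w h₁).pullback Ff σ))) =
    pi1Map (𝒦.pull (ψ.base.branchMap b₁) (ψ.base.vertexMap w)
        (ψ.base.abuts_branchMap b₁ w h₁)).pullback _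
      (pi1Map (ψ.φE (ℋ.graph.edgeOf b₁) (𝒦.graph.edgeOf (ψ.base.branchMap b₁))
        (ψ.base.edgeOf_branchMap b₁).symm).pullback Ff σ) := by
  rw [← autMulEquivOfIso_alignIso_pi1Map ψ b₁ w h₁ (ψ.base.branchMap b₁) rfl
    ((ℋ.pull b₁ w h₁).pullback ⋙ Ff) Ff (Iso.refl _) σ]
  exact (Aut.autMulEquivOfIso _).symm_apply_apply _

/-- **Branch alignment (i) ⟹ equal stabilisers.**  In the frame `Aut(b₀^* ⋙ ψ_f^* ⋙ F_f)`: if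
`ι_w(Π_w)` (read along `b₀`) is the stabiliser of `x₀ ∈ F_f(ψ_f^*(b₀^* P))` and `Π_f = Stab(q₁)` for
`q₁ ∈ F_f(ψ_f^* Q)`, `Q ↪ b₀^* P`, then `Stab_{Π_e}(x₀) = Stab_{Π_e}(q₁)` — abc-iut-w4-d079's
`comap_range_eq_range_of_aligned` along the 2-cell square, clause (i) in abc-iut-L3-t1's equality form
supplying `ι_w(Π_{b₁}) = ι_w(Π_w) ∩ Π_{b₀}^{al}`. [cite: MochizukiSemiAnbd2006, Def. 2.2(i) p.23] -/
theorem Hom.stabilizer_eq_of_isBranchAligned (hB : ψ.IsBranchAligned)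
    (x₀ : ((𝒦.pull (ψ.base.branchMap b₁) (ψ.base.vertexMap w)
      (ψ.base.abuts_branchMap b₁ w h₁)).pullback ⋙
        (ψ.φE (ℋ.graph.edgeOf b₁) (𝒦.graph.edgeOf (ψ.base.branchMap b₁))
          (ψ.base.edgeOf_branchMap b₁).symm).pullback ⋙ Ff).obj P)
    (hx : ((Aut.autMulEquivOfIso (ψ.alignIso b₁ w h₁ (ψ.base.branchMap b₁) rfl
        ((ℋ.pull b₁ w h₁).pullback ⋙ Ff) Ff (Iso.refl _)).symm).toMonoidHom.comp
        (pi1Map (ψ.φV w).pullback ((ℋ.pull b₁ w h₁).pullback ⋙ Ff))).range =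
      MulAction.stabilizer _ x₀)
    (iQ : Q ⟶ (𝒦.pull (ψ.base.branchMap b₁) (ψ.base.vertexMap w)
      (ψ.base.abuts_branchMap b₁ w h₁)).pullback.obj P) [Mono iQ]
    (q₁ : ((ψ.φE (ℋ.graph.edgeOf b₁) (𝒦.graph.edgeOf (ψ.base.branchMap b₁))
          (ψ.base.edgeOf_branchMap b₁).symm).pullback ⋙ Ff).obj Q)
    (hq : (pi1Map (ψ.φE (ℋ.graph.edgeOf b₁) (𝒦.graph.edgeOf (ψ.base.branchMap b₁))
        (ψ.base.edgeOf_branchMap b₁).symm).pullback Ff).range = MulAction.stabilizer _ q₁) :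
    @MulAction.stabilizer (Aut ((ψ.φE (ℋ.graph.edgeOf b₁) (𝒦.graph.edgeOf (ψ.base.branchMap b₁))
          (ψ.base.edgeOf_branchMap b₁).symm).pullback ⋙ Ff))
        (((ψ.φE (ℋ.graph.edgeOf b₁) (𝒦.graph.edgeOf (ψ.base.branchMap b₁))
          (ψ.base.edgeOf_branchMap b₁).symm).pullback ⋙ Ff).obj
          ((𝒦.pull (ψ.base.branchMap b₁) (ψ.base.vertexMap w)
            (ψ.base.abuts_branchMap b₁ w h₁)).pullback.obj P)) _ _ x₀ =
      MulAction.stabilizer _ q₁ := by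
  -- notation: `Fe := ψ_f^* ⋙ F_f`, `R := b₀^*`, the four homomorphisms of the square
  let Fw : ℋ.V w ⥤ FintypeCat.{v₁} := (ℋ.pull b₁ w h₁).pullback ⋙ Ff
  haveI : FiberFunctor Fw := fiberFunctor_comp_of_exact _ Ff
  let Fe := (ψ.φE (ℋ.graph.edgeOf b₁) (𝒦.graph.edgeOf (ψ.base.branchMap b₁))
    (ψ.base.edgeOf_branchMap b₁).symm).pullback ⋙ Ff
  haveI : FiberFunctor Fe := fiberFunctor_comp_of_exact _ Ff
  let R := (𝒦.pull (ψ.base.branchMap b₁) (ψ.base.vertexMap w) (ψ.base.abuts_branchMap b₁ w h₁)).pullback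
  let j : Aut Fe →* Aut (R ⋙ Fe) := pi1Map R Fe
  let ιw : Aut Ff →* Aut Fe := pi1Map (ψ.φE (ℋ.graph.edgeOf b₁) (𝒦.graph.edgeOf (ψ.base.branchMap b₁))
    (ψ.base.edgeOf_branchMap b₁).symm).pullback Ff
  let k : Aut Ff →* Aut Fw :=
    (Aut.autMulEquivOfIso (Iso.refl Fw)).toMonoidHom.comp (pi1Map (ℋ.pull b₁ w h₁).pullback Ff)
  let A := Aut.autMulEquivOfIso (ψ.alignIso b₁ w h₁ (ψ.base.branchMap b₁) rfl Fw Ff (Iso.refl _))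
  let ι : Aut Fw →* Aut (R ⋙ Fe) := A.symm.toMonoidHom.comp (pi1Map (ψ.φV w).pullback Fw)
  -- the square commutes (the 2-cell `ψ_{b₁}`, pointwise)
  have hsq : j.comp ιw = ι.comp k := by
    refine MonoidHom.ext fun σ => ?_
    exact (Hom.isBranchAligned_square ψ b₁ w h₁ Ff σ).symm
  -- clause (i), equality form, transported along `A⁻¹`
  have hi := map_branchSubgroup_eq_range_inf_aligned ψ hB b₁ w h₁ (ψ.base.branchMap b₁) rfl Fw Ff
    (Iso.refl _)
  have ha : (ι.comp k).range = ι.range ⊓ j.range := by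
    have h1 : ℋ.branchSubgroup Fw b₁ h₁ Ff (Iso.refl _) = k.range := rfl
    have h2 : ψ.alignedBranchSubgroup b₁ w h₁ (ψ.base.branchMap b₁) rfl Fw Ff (Iso.refl _) =
        (A.toMonoidHom.comp j).range := rfl
    rw [h1, h2] at hi
    have h3 : A.symm.toMonoidHom.comp (A.toMonoidHom.comp j) = j := by
      refine MonoidHom.ext fun x => ?_
      exact A.symm_apply_apply _
    have hi' := congrArg (Subgroup.map A.symm.toMonoidHom) hi
    rw [Subgroup.map_map, ← MonoidHom.range_comp, Subgroup.map_inf_eq _ _ _ A.symm.injective,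
      ← MonoidHom.range_comp, ← MonoidHom.range_comp, h3] at hi'
    exact hi'
  -- `ker (Π_e → Aut(b₀^* ⋙ Fe)) ≤ Π_f = Stab(q₁)` (`Q ↪ b₀^* P`)
  have hker : j.ker ≤ ιw.range := by
    rw [hq]
    intro g hg
    have hfix : g • Fe.map iQ q₁ = Fe.map iQ q₁ := by
      have h1 : (j g) • (show (R ⋙ Fe).obj P from Fe.map iQ q₁) = Fe.map iQ q₁ := by
        rw [MonoidHom.mem_ker.mp hg, one_smul]
      exact h1
    rw [MulAction.mem_stabilizer_iff]
    haveI : Mono (Fe.map iQ) := inferInstance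
    apply ConcreteCategory.injective_of_mono_of_preservesPullback (Fe.map iQ)
    rw [map_smul_aut]
    exact hfix
  have hc := comap_range_eq_range_of_aligned ι j ιw k hsq ha hker
  have hc' : (MulAction.stabilizer _ x₀).comap j = MulAction.stabilizer _ q₁ := by
    rw [← hx, ← hq]
    exact hc
  rw [← hc']
  ext g
  rfl

/-- **`F_e(σ_b)(q₁) = x₀`**: the branch section carries the LOCAL base point `q₁` of the edge
constituent (from `(α_f, e_f)`) to the base point `x₀` of `b₀^* P` determined by `(α_w, e_w)` and the
2-cell `ψ_{b₁}` (`sec = unit ≫ (Q × σ_b)` transposes back; `α_f(sec) ≫ e_f⁻¹` unfolds, through the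
triangle identities of `α_f`, to the comparison of the two terminal objects `α_f(𝟙_Q)`, `b₁^*(α_w 𝟙_P)`
of `ℋ_f` followed by `b₁^*(α_w(Δ) ≫ e_w⁻¹) ≫ ψ_{b₁}`). [cite: MochizukiSemiAnbd2006, Rem. 2.4.2 p.26] -/
theorem Hom.map_branchSection_basePoint (t : Ff.obj (αf.obj (Over.mk (𝟙 Q))))
    (t₀ : Ff.obj ((ℋ.pull b₁ w h₁).pullback.obj (αw.obj (Over.mk (𝟙 P))))) :
    ((ψ.φE (ℋ.graph.edgeOf b₁) (𝒦.graph.edgeOf (ψ.base.branchMap b₁))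
        (ψ.base.edgeOf_branchMap b₁).symm).pullback ⋙ Ff).map
        (Hom.branchSection ψ b₁ w h₁ P αw Q αf ew ef)
        (Ff.map (αf.map ((Over.forgetAdjStar Q).unit.app (Over.mk (𝟙 Q))) ≫ ef.inv.app Q) t) =
      Ff.map ((ψ.φB b₁ w h₁).hom.app P)
        (Ff.map ((ℋ.pull b₁ w h₁).pullback.map
          (αw.map ((Over.forgetAdjStar P).unit.app (Over.mk (𝟙 P))) ≫ ew.inv.app P)) t₀) := by
  let R := (𝒦.pull (ψ.base.branchMap b₁) (ψ.base.vertexMap w) (ψ.base.abuts_branchMap b₁ w h₁)).pullback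
  let Bp := (ℋ.pull b₁ w h₁).pullback
  let Qf := (ψ.φE (ℋ.graph.edgeOf b₁) (𝒦.graph.edgeOf (ψ.base.branchMap b₁))
    (ψ.base.edgeOf_branchMap b₁).symm).pullback
  let Qw := (ψ.φV w).pullback
  let T : ℋ.E (ℋ.graph.edgeOf b₁) := Bp.obj (αw.obj (Over.mk (𝟙 P)))
  let Z : Over Q := (Over.star Q).obj (R.obj P)
  let σ : Q ⟶ R.obj P := Hom.branchSection ψ b₁ w h₁ P αw Q αf ew ef
  let sec : Over.mk (𝟙 Q) ⟶ Z :=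
    OverStar.section_ (Over.forgetAdjStar P) (Hom.branchLocalFunctor ψ b₁ w h₁ P αw Q αf) R
      (Hom.branchLocalIso ψ b₁ w h₁ P αw Q αf ew ef) (Hom.branchLocalFunctor_isTerminal ψ b₁ w h₁ P αw Q αf)
  let c₀ : Over.mk (𝟙 Q) ⟶ αf.inv.obj T :=
    (Hom.branchLocalFunctor_isTerminal ψ b₁ w h₁ P αw Q αf).from (Over.mk (𝟙 Q))
  let uP : Over.mk (𝟙 P) ⟶ (Over.star P).obj P := (Over.forgetAdjStar P).unit.app (Over.mk (𝟙 P))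
  let uQ : Over.mk (𝟙 Q) ⟶ (Over.star Q).obj Q := (Over.forgetAdjStar Q).unit.app (Over.mk (𝟙 Q))
  let X₁ : T ⟶ Bp.obj (αw.obj ((Over.star P).obj P)) := Bp.map (αw.map uP)
  let X₂ : Bp.obj (αw.obj ((Over.star P).obj P)) ⟶ Bp.obj (Qw.obj P) := Bp.map (ew.inv.app P)
  let X₃ : Bp.obj (Qw.obj P) ⟶ Qf.obj (R.obj P) := (ψ.φB b₁ w h₁).hom.app P
  let X₄ : Qf.obj (R.obj P) ⟶ αf.obj Z := ef.hom.app (R.obj P)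
  let Y₁ : αf.obj (Over.mk (𝟙 Q)) ⟶ αf.obj ((Over.star Q).obj Q) := αf.map uQ
  let Y₂ : αf.obj ((Over.star Q).obj Q) ⟶ Qf.obj Q := ef.inv.app Q
  let η : αf.inv.obj (αf.obj Z) ⟶ Z := αf.asEquivalence.unitIso.inv.app Z
  let η' : Z ⟶ αf.inv.obj (αf.obj Z) := αf.asEquivalence.unitIso.hom.app Z
  let εh : ∀ X : ℋ.E (ℋ.graph.edgeOf b₁), αf.obj (αf.inv.obj X) ⟶ X :=
    fun X => αf.asEquivalence.counit.app X
  let εi : ∀ X : ℋ.E (ℋ.graph.edgeOf b₁), X ⟶ αf.obj (αf.inv.obj X) :=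
    fun X => αf.asEquivalence.counitInv.app X
  let c : αf.obj (Over.mk (𝟙 Q)) ⟶ T := αf.map c₀ ≫ εh T
  have h0 : Ff.map ((ψ.φB b₁ w h₁).hom.app P) (Ff.map ((ℋ.pull b₁ w h₁).pullback.map
        (αw.map ((Over.forgetAdjStar P).unit.app (Over.mk (𝟙 P))) ≫ ew.inv.app P)) t₀) =
      Ff.map (X₁ ≫ X₂ ≫ X₃) t₀ := by
    rw [← Category.assoc, show X₁ ≫ X₂ = Bp.map (αw.map uP ≫ ew.inv.app P) from
      (Bp.map_comp _ _).symm, Ff.map_comp _ X₃]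
    rfl
  have h0' : Ff.map (αf.map ((Over.forgetAdjStar Q).unit.app (Over.mk (𝟙 Q))) ≫ ef.inv.app Q) t =
      Ff.map (Y₁ ≫ Y₂) t := rfl
  have hT : IsTerminal T := by
    haveI : PreservesFiniteLimits Bp := (ℋ.pull b₁ w h₁).property.1
    exact (Over.mkIdTerminal.isTerminalObj αw (Over.mk (𝟙 P))).isTerminalObj Bp _
  obtain ⟨eT⟩ := nonempty_equiv_fiber_terminal_punit Ff
  have hsub : Subsingleton (Ff.obj T) :=
    ((FintypeCat.equivEquivIso.symm (Ff.mapIso (hT.uniqueUpToIso terminalIsTerminal))).trans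
      eT).subsingleton
  have hc : Ff.map c t = t₀ := hsub.elim _ _
  -- the equivalence `α_f`: naturality of the counit and the triangle identity
  have hfi : ∀ {X Y : ℋ.E (ℋ.graph.edgeOf b₁)} (f : X ⟶ Y),
      αf.map (αf.inv.map f) = εh X ≫ f ≫ εi Y := fun f => αf.fun_inv_map _ _ f
  have hεε : ∀ X, εi X ≫ εh X = 𝟙 X := fun X => αf.asEquivalence.counitIso.inv_hom_id_app X
  have hεη : εi (αf.obj Z) = αf.map η' := αf.asEquivalence.counitInv_app_functor Z
  have hηη : η' ≫ η = 𝟙 Z := αf.asEquivalence.unitIso.hom_inv_id_app Z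
  have hunit : εi (αf.obj Z) ≫ αf.map η = 𝟙 (αf.obj Z) := by
    rw [hεη, ← αf.map_comp, hηη, CategoryTheory.Functor.map_id]
  have hX₄ : X₄ ≫ ef.inv.app (R.obj P) = 𝟙 (Qf.obj (R.obj P)) := ef.hom_inv_id_app (R.obj P)
  -- (1) the section is the unit followed by `Q × σ` (transposition), and it unfolds to:
  have hsec₀ : sec = uQ ≫ (Over.star Q).map σ :=
    OverStar.eq_unit_comp_map_tr (Over.forgetAdjStar Q) sec
  have hdiag : OverStar.diagTop (Over.forgetAdjStar P) = uP ≫ (Over.star P).map (𝟙 P) := rfl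
  have hX₁ : Bp.map (αw.map (OverStar.diagTop (Over.forgetAdjStar P))) = X₁ := by
    rw [hdiag, CategoryTheory.Functor.map_id, Category.comp_id]
  have hsec₁ : sec = c₀ ≫ αf.inv.map (Bp.map (αw.map (OverStar.diagTop (Over.forgetAdjStar P)))) ≫
      αf.inv.map X₂ ≫ αf.inv.map X₃ ≫ αf.inv.map X₄ ≫ η := rfl
  have hsec₂ : sec = c₀ ≫ αf.inv.map X₁ ≫ αf.inv.map X₂ ≫ αf.inv.map X₃ ≫ αf.inv.map X₄ ≫ η := by
    rw [hsec₁, hX₁]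
  -- (2) hence `α_f(sec) ≫ e_f⁻¹ = c ≫ X₁ ≫ X₂ ≫ X₃`
  have h2 : αf.map sec ≫ ef.inv.app (R.obj P) = c ≫ X₁ ≫ X₂ ≫ X₃ := by
    rw [hsec₂]
    simp only [Functor.map_comp, Category.assoc]
    rw [hfi X₁, hfi X₂, hfi X₃, hfi X₄]
    simp only [Category.assoc]
    rw [reassoc_of% (hεε (Bp.obj (αw.obj ((Over.star P).obj P)))),
      reassoc_of% (hεε (Bp.obj (Qw.obj P))), reassoc_of% (hεε (Qf.obj (R.obj P))),
      reassoc_of% hunit, hX₄, Category.comp_id]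
    exact (Category.assoc _ _ _).symm
  -- (3) the local side: `(Y₁ ≫ Y₂) ≫ ψ_f^*(σ) = α_f(sec) ≫ e_f⁻¹` (naturality of `e_f⁻¹`)
  have hnat : Y₂ ≫ Qf.map σ = αf.map ((Over.star Q).map σ) ≫ ef.inv.app (R.obj P) :=
    (ef.inv.naturality σ).symm
  have h3 : (Y₁ ≫ Y₂) ≫ Qf.map σ = αf.map sec ≫ ef.inv.app (R.obj P) := by
    rw [hsec₀, Functor.map_comp, Category.assoc, Category.assoc, hnat]
  have hL : (Qf ⋙ Ff).map σ (Ff.map (αf.map ((Over.forgetAdjStar Q).unit.app (Over.mk (𝟙 Q))) ≫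
      ef.inv.app Q) t) = Ff.map ((Y₁ ≫ Y₂) ≫ Qf.map σ) t := by
    rw [h0', Ff.map_comp _ (Qf.map σ)]
    rfl
  rw [hL, h3, h2, Ff.map_comp, FintypeCat.comp_apply, hc, h0]

end Mono


/-- Conjugation by an identity isomorphism, composed: the identity. [folklore] -/
private theorem autMulEquivOfIso_refl_comp {C' : Type*} [Category C'] {G : C'} {M : Type*}
    [Group M] (f : M →* Aut G) : (Aut.autMulEquivOfIso (Iso.refl G)).toMonoidHom.comp f = f := by
  refine MonoidHom.ext fun x => Iso.ext ?_
  show (Iso.refl G).inv ≫ (f x).hom ≫ (Iso.refl G).hom = (f x).hom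
  simp

/-- **Branch alignment (i) ⟹ the branch section is a monomorphism** ([SemiAnbd] Def. 2.2 (i) /
Rem. 2.4.2): for `ψ : ℋ → 𝒦` branch-aligned, a branch `b₁` at `w` over `b₀`, local witnesses
`(α_w, e_w)` at `w` and `(α_f, e_f)` at the edge of `b₁`, with `Q` a CONNECTED sub-object of `b₀^* P`
(the local clause's branch item), the section map `σ_b : Q ⟶ b₀^* P` of the branch functor is a
monomorphism — so `b₁^*` read through the local equivalences IS print's gluing functor along the
component `σ_b(Q) ≅ Q` of `b₀^* P`. [cite: MochizukiSemiAnbd2006, Def. 2.2(i) p.23] -/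
theorem Hom.mono_branchSection (hB : ψ.IsBranchAligned) [PreGaloisCategory.IsConnected Q]
    (iQ : Q ⟶ (𝒦.pull (ψ.base.branchMap b₁) (ψ.base.vertexMap w)
      (ψ.base.abuts_branchMap b₁ w h₁)).pullback.obj P) [Mono iQ] :
    Mono (Hom.branchSection ψ b₁ w h₁ P αw Q αf ew ef) := by
  let Bp := (ℋ.pull b₁ w h₁).pullback
  let Qf := (ψ.φE (ℋ.graph.edgeOf b₁) (𝒦.graph.edgeOf (ψ.base.branchMap b₁))
    (ψ.base.edgeOf_branchMap b₁).symm).pullback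
  let Ff : ℋ.E (ℋ.graph.edgeOf b₁) ⥤ FintypeCat.{v₁} := GaloisCategory.getFiberFunctor _
  let Fe := Qf ⋙ Ff
  haveI : FiberFunctor Fe := fiberFunctor_comp_of_exact _ Ff
  let Fw := Bp ⋙ Ff
  haveI : FiberFunctor Fw := fiberFunctor_comp_of_exact _ Ff
  haveI : PreservesFiniteLimits Bp := (ℋ.pull b₁ w h₁).property.1
  haveI : PreservesLimitsOfShape WalkingCospan Fw := inferInstance
  haveI : Fw.PreservesMonomorphisms := inferInstance
  obtain ⟨eQ⟩ := nonempty_equiv_fiber_terminal_punit Ff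
  let iQ' : αf.obj (Over.mk (𝟙 Q)) ≅ ⊤_ _ :=
    (Over.mkIdTerminal.isTerminalObj αf (Over.mk (𝟙 Q))).uniqueUpToIso terminalIsTerminal
  let t : Ff.obj (αf.obj (Over.mk (𝟙 Q))) :=
    (FintypeCat.equivEquivIso.symm (Ff.mapIso iQ')).symm (eQ.symm PUnit.unit)
  have hT : IsTerminal (Bp.obj (αw.obj (Over.mk (𝟙 P)))) :=
    (Over.mkIdTerminal.isTerminalObj αw (Over.mk (𝟙 P))).isTerminalObj Bp _
  let eT := (FintypeCat.equivEquivIso.symm (Ff.mapIso (hT.uniqueUpToIso terminalIsTerminal))).trans eQ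
  haveI : Subsingleton (Fw.obj (αw.obj (Over.mk (𝟙 P)))) := eT.subsingleton
  let t₀ : Fw.obj (αw.obj (Over.mk (𝟙 P))) := eT.symm PUnit.unit
  let q₁ : Fe.obj Q :=
    Ff.map (αf.map ((Over.forgetAdjStar Q).unit.app (Over.mk (𝟙 Q))) ≫ ef.inv.app Q) t
  have hq : (pi1Map Qf Ff).range = MulAction.stabilizer (Aut Fe) q₁ := by
    have h := range_pi1Map_eq_stabilizer αf ef Ff (Iso.refl (Qf ⋙ Ff)) t
    rw [autMulEquivOfIso_refl_comp] at h
    exact h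
  have hx := range_pi1Map_eq_stabilizer' αw ew Fw
    (ψ.alignIso b₁ w h₁ (ψ.base.branchMap b₁) rfl Fw Ff (Iso.refl _)).symm t₀
  have heq := Hom.stabilizer_eq_of_isBranchAligned ψ b₁ w h₁ P Q Ff hB _ hx iQ q₁ hq
  refine mono_of_stabilizer_le Fe (Hom.branchSection ψ b₁ w h₁ P αw Q αf ew ef) q₁ (le_of_eq ?_)
  have h1 : Fe.map (Hom.branchSection ψ b₁ w h₁ P αw Q αf ew ef) q₁ =
      Ff.map ((ψ.φB b₁ w h₁).hom.app P) (Ff.map (Bp.map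
        (αw.map ((Over.forgetAdjStar P).unit.app (Over.mk (𝟙 P))) ≫ ew.inv.app P)) t₀) :=
    Hom.map_branchSection_basePoint ψ b₁ w h₁ P αw Q αf ew ef Ff t t₀
  rw [h1]
  exact heq

end SemiGraphOfAnabelioids

end Literature.AnabelianGeometry.SemiGraphs
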